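import Summits.AtomisticToContinuum.HydrodynamicLimit.Theorems.AntiMazurCoboundariesCellForecastPressureDecayEntropyBallObjects
import Summits.AtomisticToContinuum.HydrodynamicLimit.Theorems.AntiMazurCoboundariesInfluenceLocalityForecastWorldsGood
import Summits.AtomisticToContinuum.HydrodynamicLimit.Theorems.CorrectorPressureDecay.Negative.Frame

/-!
# Frame lemmas for `stub_influenceLocality` (`TorusInfluenceLocality`) of the line
# `entropy-ball-invariant-states` (crux `CellForecastPressureDecay`, stmt-AtomisticToContinuum-13915)

Helper file (`--supports stmt-AtomisticToContinuum-13915`) for the registered stub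
`stub_influenceLocality : TorusInfluenceLocality` of the objects module
`AntiMazurCoboundariesCellForecastPressureDecayEntropyBallObjects`: the structure of the torus canonical
Gibbs law `torusGibbs ε n Φ` (`n` spheres of diameter `ε` on `𝕋³`, hard-core-uniform positions, standard
Maxwellian velocities) that every estimate of the stub consumes, at GENERAL `(ε, n)` (the stub needs all
`n ≤ 2Λ³` at diameter `σ/Λ`, so the `N + 1` / `hsDiameter σ N` frame of `HardSphereEuler` is not enough).

* § 1 `torusGibbs ≪ Liouville` (`torusGibbs_absolutelyContinuous`), its flow-free form
  (`torusGibbs_eq_withDensity`), and the NULL SETS of the stub (`ae_torusGibbs_good`): `torusGibbs`-a.e. datum is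
  good for the true flow `Φ` AND every one of its sub-configurations `Config.restrictTo S z` is a good datum of the
  cluster flow `Ψ S.card` — so the forecast worlds `localClusterState Ψ R · z i` are genuine isolated hard-sphere
  evolutions (`clusterStateIn_of_mem_good`). Imported from the sibling line of crux 13916
  (`TrueAnchoredInfection.ae_liouville_restrictTo_mem_good`, general `ε`, `n`).
* § 2 the GAUSSIAN DISINTEGRATION (`lintegral_torusGibbs`): the profile `M(v)` is the rung-0 local Gibbs profile
  `(a, u, θ) = (1, 0, 1)` (`torusProfile_eq`), so for measurable `G ≥ 0`
  `∫⁻ G dG_{ε,n} = ∫⁻ dx Z⁻¹ 𝟙[no overlap](x) ∫⁻ G(x, v) N(0, I₃)^{⊗n}(dv)`: conditionally on the positions the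
  velocities are i.i.d. STANDARD GAUSSIAN (`velMeasure_std`, via `CorrectorPressureDecayNegative.gaussMeasure_zero_one`), `Z = posPartition 1 ε n`
  (`canonicalPartition_torus`). This is the Maxwellian-tail input of the stub (number of fast particles).
* § 3 NORMALISATION: total mass `Z⁻¹ · Z ≤ 1` (`torusGibbs_univ`, `torusGibbs_univ_le_one`; the zero measure iff
  `Z = 0`), and `Z > 0` — hence a probability measure — as soon as a grid configuration fits
  (`posPartition_one_pos`: `n ≤ m³`, `ε < 1/m`); in the stub's units `σ ≤ 1/4`, `Λ ≥ 1`, `n ≤ 2Λ³` suffice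
  (`isProbabilityMeasure_torusGibbs_cell`). So the stub is NOT vacuous.
* § 4 the TRIVIAL REGIME of the stub (`lintegral_exp_mul_card_le`, `influenceBound_of_mul_le`): the integrand is
  at most `e^{lam n}` and the mass at most `1`, so the stub's inequality holds whenever `lam · n ≤ δ Λ³` — the content
  of the stub is the density window `n/Λ³ ∈ (δ/lam, 2]`.

All declarations live in the sub-namespace `…Theorems.EntropyBall.InfluenceLocality` (no clash with the sibling
workers' files of the line). No dynamics is computed here; see the worker audit `InfluenceLocality-AUDIT.md` of the line for the adversarial
reading of the statement (no junk, no cheap configuration family; `R₀(σ,s,lam,δ)` at least `poly(s)·e^{lam/2}`).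
-/

noncomputable section

open MeasureTheory ProbabilityTheory Set Filter Topology
open scoped ENNReal Classical

namespace Summit.AtomisticToContinuum.HydrodynamicLimit.Theorems.EntropyBall.InfluenceLocality

open Summit.AtomisticToContinuum.HydrodynamicLimit.Theorems (CorrectorPressureDecayNegative.gaussMeasure_zero_one)
open Literature.MathematicalPhysics.KineticTheory (T3 V3 localGibbsProfile posWeight posPartition posDomain
  velMeasure zipConfig gaussMeasure canonicalPartition_eq_posPartition lintegral_gibbsWeight_mul
  canonicalDensity_eq_zero_of_notMem measurable_canonicalDensity measurable_localGibbsProfile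
  posWeight_nonneg posPartition_nonneg ofReal_posPartition integrable_posWeight measurable_posWeight
  exists_config_inv_le_euclidDist isOpen_setOf_lt_euclidDist)
open Literature.Analysis.FluidPDE
open Summit.AtomisticToContinuum.HydrodynamicLimit.Theorems.TrueAnchoredInfection (G3
  ae_liouville_restrictTo_mem_good)

variable {ε : ℝ} {n : ℕ}

/-! ## § 1 Absolute continuity and the null sets of the stub -/

/-- The velocity profile of `torusGibbs` is the rung-0 local Gibbs profile `(a, u, θ) = (1, 0, 1)`:
`M(v) = 1 · M_{1,0,1}(v)` (`localMaxwellian_one_one_zero`). -/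
theorem torusProfile_eq :
    (fun p : T3 × V3 => globalMaxwellian p.2) =
      localGibbsProfile (fun _ => (1 : ℝ)) (fun _ => (0 : V3)) (fun _ => (1 : ℝ)) := by
  funext p
  simp only [localGibbsProfile, one_mul]
  exact (congrFun localMaxwellian_one_one_zero p.2).symm

/-- Flow-free form: `torusGibbs ε n Φ` is Lebesgue measure on phase space with density the canonical density
(the restriction to the hard-sphere domain inside `particleLaw` is invisible, the density vanishing off it). -/
theorem torusGibbs_eq_withDensity (Φ : TorusFlow ε n) :
    torusGibbs ε n Φ = volume.withDensity fun z => ENNReal.ofReal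
      (canonicalDensity G3 ε n (fun p : T3 × V3 => globalMaxwellian p.2) z) :=
  particleLaw_eq_withDensity Φ fun _ hz => canonicalDensity_eq_zero_of_notMem _ _ _ _ hz

/-- In particular `torusGibbs ε n Φ` does not depend on the flow `Φ` (which only fixes the phase space). -/
theorem torusGibbs_eq_of_flow (Φ Φ' : TorusFlow ε n) : torusGibbs ε n Φ = torusGibbs ε n Φ' := by
  rw [torusGibbs_eq_withDensity, torusGibbs_eq_withDensity]

/-- `torusGibbs ≪ Liouville` (`particleLaw = liouville.withDensity`). -/
theorem torusGibbs_absolutelyContinuous (Φ : TorusFlow ε n) : torusGibbs ε n Φ ≪ liouville G3 n ε := by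
  rw [torusGibbs, particleLaw_eq]
  exact withDensity_absolutelyContinuous _ _

/-- **The null sets of the stub.** `torusGibbs`-almost every datum is good for the true flow `Φ` AND all its
sub-configurations are good data of the cluster flows `Ψ k` (so every forecast world
`t ↦ (Ψ |S|).flow t (restrictTo S z)`, `S = rangeCluster G3 R z i`, is a hard-sphere trajectory started from the
true states, and `localClusterState Ψ R t z i` is its `i`-th member, `clusterStateIn_of_mem_good`). -/
theorem ae_torusGibbs_good (Φ : TorusFlow ε n) (Ψ : TorusClusterFlows ε) :
    ∀ᵐ z ∂(torusGibbs ε n Φ), z ∈ Φ.good ∧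
      ∀ S : Finset (Fin n), Config.restrictTo S z ∈ (Ψ S.card).good :=
  (torusGibbs_absolutelyContinuous Φ).ae_le (Φ.ae_mem_good.and (ae_liouville_restrictTo_mem_good Ψ))

/-- Specialisation to the range clusters of the stub: a.s. the datum is good and, for every particle `i` and
every range `R`, the range-`R` cluster of `i` restricts to a good datum of its cluster flow. -/
theorem ae_torusGibbs_rangeCluster_good (Φ : TorusFlow ε n) (Ψ : TorusClusterFlows ε) :
    ∀ᵐ z ∂(torusGibbs ε n Φ), z ∈ Φ.good ∧ ∀ (R : ℝ) (i : Fin n),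
      Config.restrictTo (rangeCluster G3 R z i) z ∈ (Ψ (rangeCluster G3 R z i).card).good := by
  filter_upwards [ae_torusGibbs_good Φ Ψ] with z hz
  exact ⟨hz.1, fun R i => hz.2 _⟩

/-! ## § 2 The Gaussian disintegration -/

/-- Conditionally on the positions, the velocities of `torusGibbs` are i.i.d. standard Gaussian. -/
theorem velMeasure_std (x : Fin n → T3) :
    velMeasure (fun _ => (0 : V3)) (fun _ => (1 : ℝ)) x = Measure.pi fun _ : Fin n => stdGaussian V3 := by
  rw [velMeasure]
  simp_rw [CorrectorPressureDecayNegative.gaussMeasure_zero_one]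

/-- The canonical partition function of `torusGibbs` is the configurational one,
`Z = ∫ 𝟙[no overlap] dx = posPartition 1 ε n` (the Maxwellians integrate to one). -/
theorem canonicalPartition_torus (ε : ℝ) (n : ℕ) :
    canonicalPartition G3 ε n (fun p : T3 × V3 => globalMaxwellian p.2) = posPartition (fun _ => (1 : ℝ)) ε n := by
  rw [torusProfile_eq]
  exact canonicalPartition_eq_posPartition continuous_const continuous_const continuous_const
    (fun _ => zero_le_one) (fun _ => zero_lt_one) ε n

/-- The configurational partition function is at most `1` (`𝕋³` has unit volume). -/
theorem posPartition_one_le_one (ε : ℝ) (n : ℕ) : posPartition (fun _ : T3 => (1 : ℝ)) ε n ≤ 1 := by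
  rw [posPartition]
  have h1 : ∀ x : Fin n → T3, posWeight (fun _ : T3 => (1 : ℝ)) ε n x ≤ 1 := fun x =>
    Set.indicator_apply_le' (fun _ => by simp) (fun _ => zero_le_one)
  calc ∫ x, posWeight (fun _ : T3 => (1 : ℝ)) ε n x ≤ ∫ _ : Fin n → T3, (1 : ℝ) :=
        integral_mono (integrable_posWeight continuous_const (fun _ => zero_le_one) ε n)
          (integrable_const 1) h1
    _ = 1 := by simp

/-- **Gaussian disintegration of `torusGibbs`.** For measurable `G ≥ 0`,
`∫⁻ G dG_{ε,n} = ∫⁻ dx Z⁻¹ 𝟙[no overlap](x) ∫⁻ G(x, v) N(0, I₃)^{⊗n}(dv)`, `Z = posPartition 1 ε n`: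
the positions are hard-core-uniform and, given them, the velocities are i.i.d. standard Gaussian. -/
theorem lintegral_torusGibbs (Φ : TorusFlow ε n) {G : TorusPhase n → ℝ≥0∞} (hG : Measurable G) :
    ∫⁻ z, G z ∂(torusGibbs ε n Φ) =
      ∫⁻ x, ENNReal.ofReal ((posPartition (fun _ : T3 => (1 : ℝ)) ε n)⁻¹ *
          posWeight (fun _ : T3 => (1 : ℝ)) ε n x) *
        ∫⁻ v, G (zipConfig (x, v)) ∂(Measure.pi fun _ : Fin n => stdGaussian V3) := by
  set Z := posPartition (fun _ : T3 => (1 : ℝ)) ε n with hZ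
  have hZ0 : 0 ≤ Z⁻¹ := inv_nonneg.2 (posPartition_nonneg (fun _ => zero_le_one) ε n)
  have hprof := torusProfile_eq
  have hDm : Measurable fun z : TorusPhase n => ENNReal.ofReal
      (canonicalDensity G3 ε n (fun p : T3 × V3 => globalMaxwellian p.2) z) := by
    rw [hprof]
    exact (measurable_canonicalDensity ε n
      (measurable_localGibbsProfile continuous_const continuous_const continuous_const)).ennreal_ofReal
  calc ∫⁻ z, G z ∂(torusGibbs ε n Φ)
      = ∫⁻ z, ENNReal.ofReal (canonicalDensity G3 ε n (fun p : T3 × V3 => globalMaxwellian p.2) z) * G z := by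
        rw [torusGibbs_eq_withDensity, lintegral_withDensity_eq_lintegral_mul _ hDm hG]
        rfl
    _ = ENNReal.ofReal Z⁻¹ * ∫⁻ z, ENNReal.ofReal ((hardSphereDomain G3 n ε).indicator
          (tensorPow n (localGibbsProfile (fun _ => (1 : ℝ)) (fun _ => (0 : V3)) (fun _ => (1 : ℝ)))) z) * G z := by
        rw [← lintegral_const_mul' _ _ ENNReal.ofReal_ne_top]
        refine lintegral_congr fun z => ?_
        rw [canonicalDensity, canonicalPartition_torus, ← hZ, hprof, ENNReal.ofReal_mul hZ0, mul_assoc]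
    _ = ENNReal.ofReal Z⁻¹ * ∫⁻ x, ENNReal.ofReal (posWeight (fun _ : T3 => (1 : ℝ)) ε n x) *
          ∫⁻ v, G (zipConfig (x, v)) ∂(Measure.pi fun _ : Fin n => stdGaussian V3) := by
        rw [lintegral_gibbsWeight_mul continuous_const continuous_const continuous_const
          (fun _ => zero_le_one) (fun _ => zero_lt_one) ε n hG]
        simp_rw [velMeasure_std]
    _ = _ := by
        rw [← lintegral_const_mul' _ _ ENNReal.ofReal_ne_top]
        refine lintegral_congr fun x => ?_
        rw [ENNReal.ofReal_mul hZ0, mul_assoc]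

/-! ## § 3 Normalisation -/

/-- The total mass of `torusGibbs` is `Z⁻¹ · Z`, `Z = posPartition 1 ε n`. -/
theorem torusGibbs_univ (Φ : TorusFlow ε n) :
    torusGibbs ε n Φ univ = ENNReal.ofReal (posPartition (fun _ : T3 => (1 : ℝ)) ε n)⁻¹ *
      ENNReal.ofReal (posPartition (fun _ : T3 => (1 : ℝ)) ε n) := by
  have h := lintegral_torusGibbs Φ (G := fun _ => 1) measurable_const
  simp only [lintegral_const, measure_univ, mul_one, one_mul] at h
  have hZ0 : 0 ≤ (posPartition (fun _ : T3 => (1 : ℝ)) ε n)⁻¹ :=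
    inv_nonneg.2 (posPartition_nonneg (fun _ => zero_le_one) ε n)
  rw [h]
  simp_rw [ENNReal.ofReal_mul hZ0]
  rw [lintegral_const_mul' _ _ ENNReal.ofReal_ne_top,
    ← ofReal_posPartition continuous_const (fun _ => zero_le_one)]

/-- `torusGibbs` has total mass at most one (exactly one if `Z > 0`, zero if `Z = 0`). -/
theorem torusGibbs_univ_le_one (Φ : TorusFlow ε n) : torusGibbs ε n Φ univ ≤ 1 := by
  rw [torusGibbs_univ]
  set Z := posPartition (fun _ : T3 => (1 : ℝ)) ε n
  have hZ : 0 ≤ Z := posPartition_nonneg (fun _ => zero_le_one) ε n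
  rcases hZ.eq_or_lt with h | h
  · rw [← h]; simp
  · rw [← ENNReal.ofReal_mul (inv_nonneg.2 hZ), inv_mul_cancel₀ h.ne', ENNReal.ofReal_one]

/-- `torusGibbs` is a finite measure (a theorem, to be used via `haveI`). -/
theorem isFiniteMeasure_torusGibbs (Φ : TorusFlow ε n) : IsFiniteMeasure (torusGibbs ε n Φ) :=
  ⟨(torusGibbs_univ_le_one Φ).trans_lt ENNReal.one_lt_top⟩

/-- If the configurational partition function vanishes, `torusGibbs` is the zero measure (junk regime). -/
theorem torusGibbs_eq_zero_of_posPartition_eq_zero (Φ : TorusFlow ε n)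
    (h : posPartition (fun _ : T3 => (1 : ℝ)) ε n = 0) : torusGibbs ε n Φ = 0 := by
  rw [← Measure.measure_univ_eq_zero, torusGibbs_univ, h]
  simp

/-- If the configurational partition function is positive, `torusGibbs` is a probability measure. -/
theorem isProbabilityMeasure_torusGibbs (Φ : TorusFlow ε n)
    (h : 0 < posPartition (fun _ : T3 => (1 : ℝ)) ε n) : IsProbabilityMeasure (torusGibbs ε n Φ) := by
  refine ⟨?_⟩
  rw [torusGibbs_univ, ← ENNReal.ofReal_mul (inv_nonneg.2 h.le), inv_mul_cancel₀ h.ne', ENNReal.ofReal_one]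

/-- Dichotomy: `torusGibbs` is a probability measure or the zero measure. -/
theorem isProbabilityMeasure_torusGibbs_or_eq_zero (Φ : TorusFlow ε n) :
    IsProbabilityMeasure (torusGibbs ε n Φ) ∨ torusGibbs ε n Φ = 0 := by
  rcases (posPartition_nonneg (fun _ : T3 => zero_le_one) ε n).eq_or_lt with h | h
  · exact Or.inr (torusGibbs_eq_zero_of_posPartition_eq_zero Φ h.symm)
  · exact Or.inl (isProbabilityMeasure_torusGibbs Φ h)

/-- **Positivity of the configurational partition function**: if `n ≤ m³` and `ε < 1/m` (a cubic grid
configuration of `n` points at mutual minimal-image distance `≥ 1/m` exists and `{pairwise distance > ε}` is an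
open neighbourhood of it, of positive Haar measure), then `Z = posPartition 1 ε n > 0`. -/
theorem posPartition_one_pos {m : ℕ} (hm : 0 < m) (hn : n ≤ m ^ 3) (hε : ε < (m : ℝ)⁻¹) :
    0 < posPartition (fun _ : T3 => (1 : ℝ)) ε n := by
  rw [posPartition, integral_pos_iff_support_of_nonneg (fun x => posWeight_nonneg (fun _ => zero_le_one) _ x)
    (integrable_posWeight continuous_const (fun _ => zero_le_one) _ _)]
  obtain ⟨x₀, hx₀⟩ := exists_config_inv_le_euclidDist hm hn
  have hpos : 0 < volume {x : Fin n → T3 | ∀ i j, i ≠ j → ε < Torus.euclidDist (x i) (x j)} :=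
    (isOpen_setOf_lt_euclidDist ε n).measure_pos volume ⟨x₀, fun i j hij => hε.trans_le (hx₀ i j hij)⟩
  refine hpos.trans_le (measure_mono fun x hx => ?_)
  rw [Function.mem_support, posWeight,
    Set.indicator_of_mem (show x ∈ posDomain ε n from fun i j hij => (hx i j hij).le)]
  simp

/-- **The torus Gibbs law of the stub is a probability measure**: in the stub's units (diameter `σ/Λ`,
`n ≤ 2Λ³` spheres), `σ ≤ 1/4` and `Λ ≥ 1` suffice (grid with `m = ⌈2Λ⌉` points per side:
`n ≤ 8Λ³ ≤ m³` and `σ/Λ < 1/m` since `σ(2Λ + 1) < Λ`). So `TorusInfluenceLocality` is not vacuous. -/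
theorem isProbabilityMeasure_torusGibbs_cell {σ Λ : ℝ} (hσ : 0 < σ) (hσ4 : σ ≤ 1 / 4) (hΛ : 1 ≤ Λ)
    (hn : (n : ℝ) ≤ 2 * Λ ^ 3) (Φ : TorusFlow (σ / Λ) n) : IsProbabilityMeasure (torusGibbs (σ / Λ) n Φ) := by
  have hΛ0 : 0 < Λ := one_pos.trans_le hΛ
  set m : ℕ := ⌈2 * Λ⌉₊ with hm
  have hm2 : 2 * Λ ≤ m := Nat.le_ceil _
  have hm0' : (0 : ℝ) < m := (by linarith : (0 : ℝ) < 2 * Λ).trans_le hm2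
  have hm0 : 0 < m := by exact_mod_cast hm0'
  have hmlt : (m : ℝ) < 2 * Λ + 1 := Nat.ceil_lt_add_one (by linarith)
  refine isProbabilityMeasure_torusGibbs Φ (posPartition_one_pos hm0 ?_ ?_)
  · have h : (n : ℝ) ≤ (m : ℝ) ^ 3 := by
      calc (n : ℝ) ≤ 2 * Λ ^ 3 := hn
        _ ≤ (2 * Λ) ^ 3 := by nlinarith [pow_pos hΛ0 3]
        _ ≤ (m : ℝ) ^ 3 := pow_le_pow_left₀ (by linarith) hm2 3
    exact_mod_cast h
  · rw [div_lt_iff₀ hΛ0, ← div_eq_inv_mul, lt_div_iff₀ hm0']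
    nlinarith

/-! ## § 4 The trivial regime of the stub -/

/-- The exponential moment of `lam · #(filtered particles)`, `lam ≥ 0`, is at most `e^{lam n}` (the count is at most
`n`, the mass at most `1`). -/
theorem lintegral_exp_mul_card_le (Φ : TorusFlow ε n) {lam : ℝ} (hlam : 0 ≤ lam) (P : TorusPhase n → Fin n → Prop) :
    ∫⁻ z, ENNReal.ofReal (Real.exp (lam * ((Finset.univ.filter fun i : Fin n => P z i).card : ℝ)))
      ∂(torusGibbs ε n Φ) ≤ ENNReal.ofReal (Real.exp (lam * n)) := by
  have hpt : ∀ z : TorusPhase n, ENNReal.ofReal (Real.exp (lam * ((Finset.univ.filter fun i : Fin n => P z i).card : ℝ)))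
      ≤ ENNReal.ofReal (Real.exp (lam * n)) := by
    intro z
    refine ENNReal.ofReal_le_ofReal (Real.exp_le_exp.2 (mul_le_mul_of_nonneg_left ?_ hlam))
    have h : (Finset.univ.filter fun i : Fin n => P z i).card ≤ n :=
      (Finset.card_filter_le _ _).trans (by simp)
    exact_mod_cast h
  calc _ ≤ ∫⁻ _ : TorusPhase n, ENNReal.ofReal (Real.exp (lam * n)) ∂(torusGibbs ε n Φ) := lintegral_mono hpt
    _ = ENNReal.ofReal (Real.exp (lam * n)) * torusGibbs ε n Φ univ := lintegral_const _
    _ ≤ ENNReal.ofReal (Real.exp (lam * n)) * 1 := mul_le_mul' le_rfl (torusGibbs_univ_le_one Φ)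
    _ = _ := mul_one _

/-- **The trivial regime of `TorusInfluenceLocality`.** Whenever `lam · n ≤ δ Λ³` the stub's inequality holds
for every flow, every family of cluster flows, every horizon and every range: its content is the density window
`n/Λ³ ∈ (δ/lam, 2]`. -/
theorem influenceBound_of_mul_le {σ Λ s lam δ R : ℝ} (hlam : 0 ≤ lam) (h : lam * n ≤ δ * Λ ^ 3)
    (Φ : TorusFlow (σ / Λ) n) (Ψ : TorusClusterFlows (σ / Λ)) :
    ∫⁻ z, ENNReal.ofReal (Real.exp (lam *
        ((Finset.univ.filter fun i : Fin n =>
          ∃ t ∈ Set.Icc (0 : ℝ) (s / Λ), Φ.flow t z i ≠ localClusterState Ψ (R / Λ) t z i).card : ℝ)))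
      ∂(torusGibbs (σ / Λ) n Φ) ≤ ENNReal.ofReal (Real.exp (δ * Λ ^ 3)) :=
  (lintegral_exp_mul_card_le Φ hlam _).trans (ENNReal.ofReal_le_ofReal (Real.exp_le_exp.2 h))

/-! ## Registered form -/

/-- **Registered helper statement `stub_influenceLocalityFrame`** (sub-goal of `stub_influenceLocality`, line
`entropy-ball-invariant-states`, crux stmt-AtomisticToContinuum-13915): (i) the null sets — a.s. the datum is good
for `Φ` and all its sub-configurations are good cluster data; (ii) the Gaussian disintegration of `torusGibbs`;
(iii) mass `≤ 1`; (iv) probability measure in the stub's units for `σ ≤ 1/4`, `Λ ≥ 1`, `n ≤ 2Λ³`; (v) the trivial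
regime `lam · n ≤ δΛ³` of the stub's inequality. -/
theorem stub_influenceLocalityFrame : (∀ (ε : ℝ) (n : ℕ) (Φ : TorusFlow ε n) (Ψ : TorusClusterFlows ε), ∀ᵐ z ∂(torusGibbs ε n Φ), z ∈ Φ.good ∧ ∀ S : Finset (Fin n), Config.restrictTo S z ∈ (Ψ S.card).good) ∧ (∀ (ε : ℝ) (n : ℕ) (Φ : TorusFlow ε n) (G : TorusPhase n → ℝ≥0∞), Measurable G → ∫⁻ z, G z ∂(torusGibbs ε n Φ) = ∫⁻ x, ENNReal.ofReal ((posPartition (fun _ : T3 => (1 : ℝ)) ε n)⁻¹ * posWeight (fun _ : T3 => (1 : ℝ)) ε n x) * ∫⁻ v, G (zipConfig (x, v)) ∂(Measure.pi fun _ : Fin n => stdGaussian V3)) ∧ (∀ (ε : ℝ) (n : ℕ) (Φ : TorusFlow ε n), torusGibbs ε n Φ Set.univ ≤ 1) ∧ (∀ (σ Λ : ℝ) (n : ℕ), 0 < σ → σ ≤ 1 / 4 → 1 ≤ Λ → (n : ℝ) ≤ 2 * Λ ^ 3 → ∀ Φ : TorusFlow (σ / Λ) n, IsProbabilityMeasure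 (torusGibbs (σ / Λ) n Φ)) ∧ (∀ (σ Λ s lam δ R : ℝ) (n : ℕ), 0 ≤ lam → lam * n ≤ δ * Λ ^ 3 → ∀ (Φ : TorusFlow (σ / Λ) n) (Ψ : TorusClusterFlows (σ / Λ)), ∫⁻ z, ENNReal.ofReal (Real.exp (lam * ((Finset.univ.filter fun i : Fin n => ∃ t ∈ Set.Icc (0 : ℝ) (s / Λ), Φ.flow t z i ≠ localClusterState Ψ (R / Λ) t z i).card : ℝ))) ∂(torusGibbs (σ / Λ) n Φ) ≤ ENNReal.ofReal (Real.exp (δ * Λ ^ 3))) :=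
  ⟨fun _ _ Φ Ψ => ae_torusGibbs_good Φ Ψ, fun _ _ Φ _ hG => lintegral_torusGibbs Φ hG,
    fun _ _ Φ => torusGibbs_univ_le_one Φ, fun _ _ _ hσ hσ4 hΛ hn Φ => isProbabilityMeasure_torusGibbs_cell hσ hσ4 hΛ hn Φ,
    fun _ _ _ _ _ _ _ hlam h Φ Ψ => influenceBound_of_mul_le hlam h Φ Ψ⟩

end Summit.AtomisticToContinuum.HydrodynamicLimit.Theorems.EntropyBall.InfluenceLocality

end
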